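import Mathlib
import Summits.NavierStokesRegularity.NavierStokesRegularity.Theorems.SubOnsagerCeilingVirtualFloorChainCoupledFace
import Summits.NavierStokesRegularity.NavierStokesRegularity.Theorems.SubOnsagerCeilingGapSpecCertO1
import Summits.NavierStokesRegularity.NavierStokesRegularity.Theorems.SubOnsagerCeilingGapSpecCertO2
import Summits.NavierStokesRegularity.NavierStokesRegularity.Theorems.SubOnsagerCeilingGapSpecCertO3
import Summits.NavierStokesRegularity.NavierStokesRegularity.Theorems.SubOnsagerCeilingGapSpecCertO4
import HarnessLib

/-!
# TOPOLOGY-AS-A-DATUM ROUTE, worked instance: the chain barrier on the slice `b ∈ [34/25, 137/100]` from the spec-list design `dO`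
(helper file for crux stmt-NavierStokesRegularity-27057 `SubOnsagerCeiling.ForwardTailCeilingKP`, `--supports … --as helper`;
LEAD SOC g12, line «kp-shell-barrier»)

Assembly for the slice `b ∈ [34/25, 137/100]` through the design-AND-topology-agnostic files `SubOnsagerCeilingGapSpec{,Kernel}`: (i) the rescaling
constants `L = b^(399/200)`, `p = b^(197/200)`, `b²` lie in the rational box of the certificates (`specSliceO_consts`); (ii) the `hFace`
hypothesis of `VirtualFloor.chain_le_of_coupledFaceCertB` (ι = `Fin 13`) for `fun k => (dO k).face` at every such `b`, from the kernel
certificates through `GapSpec.inertial_of_cert` (bound `−1/4096`) / `damping_of_cert`, structural damping signs by `Spec.face_damping`;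
(iii) `hInit` by `design_init` (side conditions `Spec.InitOK` decided on the literal), `hSafe` by `design_safe`; (iv) the chain barrier
`(b^(101/200))^(2k) Z_k(t)² ≤ 100 x₀²` along every honest non-negative `ν`-viscous Katz–Pavlović chain from a one-shell datum
(`spec_gap_chain_O`). HONEST FRAMING: MODEL lattice (route SubOnsagerCeiling, TL-M2Break); nothing here bears on Navier–Stokes regularity;
27057 stays OPEN. [cite: BarbatoMorandinRomito2011, §2 Lemma 2.1, §3.2] [cite: Tao2016AveragedNS, §4 (4.5), (4.13)]
-/

noncomputable section

-- the sub-problem namespace `NavierStokesRegularity.NavierStokesRegularity` is the tree's layout (D-0017)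
set_option linter.dupNamespace false

namespace Summit.NavierStokesRegularity.NavierStokesRegularity.Theorems.VirtualFloor.GapSpec

open Set Filter Topology
open Literature.Analysis.ValidatedNumerics KernelFaceMul KernelFaceAffine
open Summit.NavierStokesRegularity.NavierStokesRegularity.Theorems.VirtualFloor
open Summit.NavierStokesRegularity.NavierStokesRegularity.Theorems.VirtualFloor.GapRung (pt pt_mem_box9)

/-! ## Numerical facts: the rescaling constants of the slice lie in the certificates' box -/

/-- `7387/4000 ≤ (34/25)^(399/200)`. [folklore] -/
theorem specSliceO_L_lo : ((7387 / 4000 : ℚ) : ℝ) ≤ (34 / 25 : ℝ) ^ ((399 : ℝ) / 200) := by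
  have h0 : (0 : ℝ) ≤ (34 / 25 : ℝ) ^ ((399 : ℝ) / 200) := by positivity
  have h2 : ((34 / 25 : ℝ) ^ ((399 : ℝ) / 200)) ^ (200 : ℕ) = (34 / 25 : ℝ) ^ (399 : ℕ) := by
    rw [← Real.rpow_natCast, ← Real.rpow_mul (by norm_num)]
    norm_num
  have hq : ¬ ((34 / 25 : ℚ) ^ (399 : ℕ) < (7387 / 4000 : ℚ) ^ (200 : ℕ)) := by decide +kernel
  have hr : ¬ ((((34 / 25 : ℚ) ^ (399 : ℕ) : ℚ) : ℝ) < (((7387 / 4000 : ℚ) ^ (200 : ℕ) : ℚ) : ℝ)) := by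
    rw [Rat.cast_lt]; exact hq
  push_cast at hr
  push_cast
  by_contra h
  push Not at h
  have h3 : ((34 / 25 : ℝ) ^ ((399 : ℝ) / 200)) ^ (200 : ℕ) < (7387 / 4000 : ℝ) ^ (200 : ℕ) :=
    pow_lt_pow_left₀ h h0 (by norm_num)
  rw [h2] at h3
  exact hr h3

/-- `(137/100)^(399/200) ≤ 37479/20000`. [folklore] -/
theorem specSliceO_L_hi : (137 / 100 : ℝ) ^ ((399 : ℝ) / 200) ≤ ((37479 / 20000 : ℚ) : ℝ) := by
  have h0 : (0 : ℝ) ≤ (137 / 100 : ℝ) ^ ((399 : ℝ) / 200) := by positivity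
  have h2 : ((137 / 100 : ℝ) ^ ((399 : ℝ) / 200)) ^ (200 : ℕ) = (137 / 100 : ℝ) ^ (399 : ℕ) := by
    rw [← Real.rpow_natCast, ← Real.rpow_mul (by norm_num)]
    norm_num
  have hq : ¬ ((37479 / 20000 : ℚ) ^ (200 : ℕ) < (137 / 100 : ℚ) ^ (399 : ℕ)) := by decide +kernel
  have hr : ¬ ((((37479 / 20000 : ℚ) ^ (200 : ℕ) : ℚ) : ℝ) < (((137 / 100 : ℚ) ^ (399 : ℕ) : ℚ) : ℝ)) := by
    rw [Rat.cast_lt]; exact hq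
  push_cast at hr
  push_cast
  by_contra h
  push Not at h
  have h3 : (37479 / 20000 : ℝ) ^ (200 : ℕ) < ((137 / 100 : ℝ) ^ ((399 : ℝ) / 200)) ^ (200 : ℕ) :=
    pow_lt_pow_left₀ h (by norm_num) (by norm_num)
  rw [h2] at h3
  exact hr h3

/-- `67687/50000 ≤ (34/25)^(197/200)`. [folklore] -/
theorem specSliceO_p_lo : ((67687 / 50000 : ℚ) : ℝ) ≤ (34 / 25 : ℝ) ^ ((197 : ℝ) / 200) := by
  have h0 : (0 : ℝ) ≤ (34 / 25 : ℝ) ^ ((197 : ℝ) / 200) := by positivity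
  have h2 : ((34 / 25 : ℝ) ^ ((197 : ℝ) / 200)) ^ (200 : ℕ) = (34 / 25 : ℝ) ^ (197 : ℕ) := by
    rw [← Real.rpow_natCast, ← Real.rpow_mul (by norm_num)]
    norm_num
  have hq : ¬ ((34 / 25 : ℚ) ^ (197 : ℕ) < (67687 / 50000 : ℚ) ^ (200 : ℕ)) := by decide +kernel
  have hr : ¬ ((((34 / 25 : ℚ) ^ (197 : ℕ) : ℚ) : ℝ) < (((67687 / 50000 : ℚ) ^ (200 : ℕ) : ℚ) : ℝ)) := by
    rw [Rat.cast_lt]; exact hq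
  push_cast at hr
  push_cast
  by_contra h
  push Not at h
  have h3 : ((34 / 25 : ℝ) ^ ((197 : ℝ) / 200)) ^ (200 : ℕ) < (67687 / 50000 : ℝ) ^ (200 : ℕ) :=
    pow_lt_pow_left₀ h h0 (by norm_num)
  rw [h2] at h3
  exact hr h3

/-- `(137/100)^(197/200) ≤ 27271/20000`. [folklore] -/
theorem specSliceO_p_hi : (137 / 100 : ℝ) ^ ((197 : ℝ) / 200) ≤ ((27271 / 20000 : ℚ) : ℝ) := by
  have h0 : (0 : ℝ) ≤ (137 / 100 : ℝ) ^ ((197 : ℝ) / 200) := by positivity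
  have h2 : ((137 / 100 : ℝ) ^ ((197 : ℝ) / 200)) ^ (200 : ℕ) = (137 / 100 : ℝ) ^ (197 : ℕ) := by
    rw [← Real.rpow_natCast, ← Real.rpow_mul (by norm_num)]
    norm_num
  have hq : ¬ ((27271 / 20000 : ℚ) ^ (200 : ℕ) < (137 / 100 : ℚ) ^ (197 : ℕ)) := by decide +kernel
  have hr : ¬ ((((27271 / 20000 : ℚ) ^ (200 : ℕ) : ℚ) : ℝ) < (((137 / 100 : ℚ) ^ (197 : ℕ) : ℚ) : ℝ)) := by
    rw [Rat.cast_lt]; exact hq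
  push_cast at hr
  push_cast
  by_contra h
  push Not at h
  have h3 : (27271 / 20000 : ℝ) ^ (200 : ℕ) < ((137 / 100 : ℝ) ^ ((197 : ℝ) / 200)) ^ (200 : ℕ) :=
    pow_lt_pow_left₀ h (by norm_num) (by norm_num)
  rw [h2] at h3
  exact hr h3

/-- The three rescaling constants lie in the slice box. [folklore] -/
theorem specSliceO_consts {b : ℝ} (hb : (34 / 25 : ℝ) ≤ b) (hb' : b ≤ (137 / 100 : ℝ)) :
    (((7387 / 4000 : ℚ) : ℝ) ≤ (b ^ ((5 : ℝ) / 2) / b ^ ((101 : ℝ) / 200)) ∧ (b ^ ((5 : ℝ) / 2) / b ^ ((101 : ℝ) / 200)) ≤ ((37479 / 20000 : ℚ) : ℝ)) ∧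
    (((67687 / 50000 : ℚ) : ℝ) ≤ (b ^ ((5 : ℝ) / 2) / (b ^ ((101 : ℝ) / 200)) ^ 3) ∧ (b ^ ((5 : ℝ) / 2) / (b ^ ((101 : ℝ) / 200)) ^ 3) ≤ ((27271 / 20000 : ℚ) : ℝ)) ∧
    (((1156 / 625 : ℚ) : ℝ) ≤ b ^ 2 ∧ b ^ 2 ≤ ((18769 / 10000 : ℚ) : ℝ)) := by
  have hb0 : 0 < b := by linarith
  have hL : (b ^ ((5 : ℝ) / 2) / b ^ ((101 : ℝ) / 200)) = b ^ ((399 : ℝ) / 200) := by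
    rw [← Real.rpow_sub hb0]; norm_num
  have hp : (b ^ ((5 : ℝ) / 2) / (b ^ ((101 : ℝ) / 200)) ^ 3) = b ^ ((197 : ℝ) / 200) := by
    rw [← Real.rpow_natCast, ← Real.rpow_mul hb0.le, ← Real.rpow_sub hb0]; norm_num
  rw [hL, hp]
  refine ⟨⟨specSliceO_L_lo.trans (Real.rpow_le_rpow (by norm_num) hb (by norm_num)),
    (Real.rpow_le_rpow hb0.le hb' (by norm_num)).trans specSliceO_L_hi⟩,
    ⟨specSliceO_p_lo.trans (Real.rpow_le_rpow (by norm_num) hb (by norm_num)),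
    (Real.rpow_le_rpow hb0.le hb' (by norm_num)).trans specSliceO_p_hi⟩, ?_, ?_⟩
  · push_cast; nlinarith
  · push_cast; nlinarith

/-! ## Region facts of the design -/

/-- Every face of `dO` satisfies `InitOK`. [folklore] -/
theorem dO_initOK : ∀ k, (dO k).InitOK := by
  intro k; fin_cases k
  · exact dO_initOK_0
  · exact dO_initOK_1
  · exact dO_initOK_2
  · exact dO_initOK_3
  · exact dO_initOK_4
  · exact dO_initOK_5
  · exact dO_initOK_6
  · exact dO_initOK_7
  · exact dO_initOK_8
  · exact dO_initOK_9
  · exact dO_initOK_10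
  · exact dO_initOK_11
  · exact dO_initOK_12

/-! ## The `hFace` hypothesis at every `b` of the slice -/

/-- **`hFace` for `dO` at every `b ∈ [34/25, 137/100]`.** [cite: BarbatoMorandinRomito2011, §2 Lemma 2.1] -/
theorem specSliceO_hFace {b : ℝ} (hb : (34 / 25 : ℝ) ≤ b) (hb' : b ≤ (137 / 100 : ℝ)) :
    ∀ k (x : Fin 4 → ℝ) (v z : ℝ), (∀ i, 0 ≤ x i) → 0 ≤ v → 0 ≤ z → (∀ i, x i ≤ (49 / 50 : ℝ)) → v ≤ (49 / 50 : ℝ) →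
      z ≤ (49 / 50 : ℝ) → (∀ k', (dO k').face x ≤ 0) → (∀ k', (dO k').face (vec4 v (x 0) (x 1) (x 2)) ≤ 0) →
      (∀ k', (dO k').face (vec4 (x 1) (x 2) (x 3) z) ≤ 0) → (dO k).face x = 0 →
      ((dO k).grad 0 x * (v ^ 2 - (b ^ ((5 : ℝ) / 2) / (b ^ ((101 : ℝ) / 200)) ^ 3) * x 0 * x 1) +
          (dO k).grad 1 x * ((b ^ ((5 : ℝ) / 2) / b ^ ((101 : ℝ) / 200)) * (x 0 ^ 2 - (b ^ ((5 : ℝ) / 2) / (b ^ ((101 : ℝ) / 200)) ^ 3) * x 1 * x 2)) +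
          (dO k).grad 2 x * ((b ^ ((5 : ℝ) / 2) / b ^ ((101 : ℝ) / 200)) ^ 2 * (x 1 ^ 2 - (b ^ ((5 : ℝ) / 2) / (b ^ ((101 : ℝ) / 200)) ^ 3) * x 2 * x 3)) +
          (dO k).grad 3 x * ((b ^ ((5 : ℝ) / 2) / b ^ ((101 : ℝ) / 200)) ^ 3 * (x 2 ^ 2 - (b ^ ((5 : ℝ) / 2) / (b ^ ((101 : ℝ) / 200)) ^ 3) * x 3 * z)) < 0) ∧
      0 ≤ (dO k).grad 0 x * x 0 + (dO k).grad 1 x * ((b ^ 2) * x 1) + (dO k).grad 2 x * ((b ^ 2) ^ 2 * x 2) +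
        (dO k).grad 3 x * ((b ^ 2) ^ 3 * x 3) := by
  intro k x v z h0 hv0 hz0 hc hvc hzc hX hLo hUp hk
  obtain ⟨hL, hp, hb2⟩ := specSliceO_consts hb hb'
  have hmem := pt_mem_box9 h0 hc hv0 hvc hz0 hzc hL hp hb2
  refine ⟨?_, ?_⟩
  · fin_cases k
    · exact inertial_of_cert (D := dO) (k := 0) dO_elimOK_0 cert_dO_O_cap1 (by norm_num) hmem h0 hc hX hLo hUp hk
    · exact inertial_of_cert (D := dO) (k := 1) dO_elimOK_1 cert_dO_O_cap2 (by norm_num) hmem h0 hc hX hLo hUp hk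
    · exact inertial_of_cert (D := dO) (k := 2) dO_elimOK_2 cert_dO_O_cap3 (by norm_num) hmem h0 hc hX hLo hUp hk
    · exact inertial_of_cert (D := dO) (k := 3) dO_elimOK_3 cert_dO_O_cub0 (by norm_num) hmem h0 hc hX hLo hUp hk
    · rcases Box.mem_split hmem 1 (49/100) with hmem' | hmem'
      · exact inertial_of_cert (D := dO) (k := 4) dO_elimOK_4 cert_dO_O_cub1_1 (by norm_num) hmem' h0 hc hX hLo hUp hk
      · rcases Box.mem_split hmem' 1 (147/200) with hmem'' | hmem''
        · rcases Box.mem_split hmem'' 1 (49/80) with hmem''' | hmem'''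
          · exact inertial_of_cert (D := dO) (k := 4) dO_elimOK_4 cert_dO_O_cub1_2 (by norm_num) hmem''' h0 hc hX hLo hUp hk
          · exact inertial_of_cert (D := dO) (k := 4) dO_elimOK_4 cert_dO_O_cub1_3 (by norm_num) hmem''' h0 hc hX hLo hUp hk
        · exact inertial_of_cert (D := dO) (k := 4) dO_elimOK_4 cert_dO_O_cub1_4 (by norm_num) hmem'' h0 hc hX hLo hUp hk
    · rcases Box.mem_split hmem 2 (49/100) with hmem' | hmem'
      · exact inertial_of_cert (D := dO) (k := 5) dO_elimOK_5 cert_dO_O_cub2_1 (by norm_num) hmem' h0 hc hX hLo hUp hk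
      · rcases Box.mem_split hmem' 2 (147/200) with hmem'' | hmem''
        · rcases Box.mem_split hmem'' 2 (49/80) with hmem''' | hmem'''
          · exact inertial_of_cert (D := dO) (k := 5) dO_elimOK_5 cert_dO_O_cub2_2 (by norm_num) hmem''' h0 hc hX hLo hUp hk
          · exact inertial_of_cert (D := dO) (k := 5) dO_elimOK_5 cert_dO_O_cub2_3 (by norm_num) hmem''' h0 hc hX hLo hUp hk
        · exact inertial_of_cert (D := dO) (k := 5) dO_elimOK_5 cert_dO_O_cub2_4 (by norm_num) hmem'' h0 hc hX hLo hUp hk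
    · exact inertial_of_cert (D := dO) (k := 6) dO_elimOK_6 cert_dO_O_capA (by norm_num) hmem h0 hc hX hLo hUp hk
    · exact inertial_of_cert (D := dO) (k := 7) dO_elimOK_7 cert_dO_O_capB (by norm_num) hmem h0 hc hX hLo hUp hk
    · rcases Box.mem_split hmem 2 (49/100) with hmem' | hmem'
      · exact inertial_of_cert (D := dO) (k := 8) dO_elimOK_8 cert_dO_O_bulk_1 (by norm_num) hmem' h0 hc hX hLo hUp hk
      · rcases Box.mem_split hmem' 2 (147/200) with hmem'' | hmem''
        · exact inertial_of_cert (D := dO) (k := 8) dO_elimOK_8 cert_dO_O_bulk_2 (by norm_num) hmem'' h0 hc hX hLo hUp hk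
        · rcases Box.mem_split hmem'' 1 (49/100) with hmem''' | hmem'''
          · exact inertial_of_cert (D := dO) (k := 8) dO_elimOK_8 cert_dO_O_bulk_3 (by norm_num) hmem''' h0 hc hX hLo hUp hk
          · rcases Box.mem_split hmem''' 2 (343/400) with hmem'''' | hmem''''
            · rcases Box.mem_split hmem'''' 1 (147/200) with hmem''''' | hmem'''''
              · exact inertial_of_cert (D := dO) (k := 8) dO_elimOK_8 cert_dO_O_bulk_4 (by norm_num) hmem''''' h0 hc hX hLo hUp hk
              · rcases Box.mem_split hmem''''' 2 (637/800) with hmem'''''' | hmem''''''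
                · exact inertial_of_cert (D := dO) (k := 8) dO_elimOK_8 cert_dO_O_bulk_5 (by norm_num) hmem'''''' h0 hc hX hLo hUp hk
                · exact inertial_of_cert (D := dO) (k := 8) dO_elimOK_8 cert_dO_O_bulk_6 (by norm_num) hmem'''''' h0 hc hX hLo hUp hk
            · rcases Box.mem_split hmem'''' 1 (147/200) with hmem''''' | hmem'''''
              · exact inertial_of_cert (D := dO) (k := 8) dO_elimOK_8 cert_dO_O_bulk_7 (by norm_num) hmem''''' h0 hc hX hLo hUp hk
              · rcases Box.mem_split hmem''''' 2 (147/160) with hmem'''''' | hmem''''''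
                · rcases Box.mem_split hmem'''''' 0 (49/100) with hmem''''''' | hmem'''''''
                  · exact inertial_of_cert (D := dO) (k := 8) dO_elimOK_8 cert_dO_O_bulk_8 (by norm_num) hmem''''''' h0 hc hX hLo hUp hk
                  · rcases Box.mem_split hmem''''''' 1 (343/400) with hmem'''''''' | hmem''''''''
                    · exact inertial_of_cert (D := dO) (k := 8) dO_elimOK_8 cert_dO_O_bulk_9 (by norm_num) hmem'''''''' h0 hc hX hLo hUp hk
                    · rcases Box.mem_split hmem'''''''' 2 (1421/1600) with hmem''''''''' | hmem'''''''''
                      · rcases Box.mem_split hmem''''''''' 0 (147/200) with hmem'''''''''' | hmem''''''''''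
                        · exact inertial_of_cert (D := dO) (k := 8) dO_elimOK_8 cert_dO_O_bulk_10 (by norm_num) hmem'''''''''' h0 hc hX hLo hUp hk
                        · rcases Box.mem_split hmem'''''''''' 1 (147/160) with hmem''''''''''' | hmem'''''''''''
                          · exact inertial_of_cert (D := dO) (k := 8) dO_elimOK_8 cert_dO_O_bulk_11 (by norm_num) hmem''''''''''' h0 hc hX hLo hUp hk
                          · exact inertial_of_cert (D := dO) (k := 8) dO_elimOK_8 cert_dO_O_bulk_12 (by norm_num) hmem''''''''''' h0 hc hX hLo hUp hk
                      · exact inertial_of_cert (D := dO) (k := 8) dO_elimOK_8 cert_dO_O_bulk_13 (by norm_num) hmem''''''''' h0 hc hX hLo hUp hk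
                · exact inertial_of_cert (D := dO) (k := 8) dO_elimOK_8 cert_dO_O_bulk_14 (by norm_num) hmem'''''' h0 hc hX hLo hUp hk
    · rcases Box.mem_split hmem 2 (49/100) with hmem' | hmem'
      · rcases Box.mem_split hmem' 2 (49/200) with hmem'' | hmem''
        · exact inertial_of_cert (D := dO) (k := 9) dO_elimOK_9 cert_dO_O_carve_1 (by norm_num) hmem'' h0 hc hX hLo hUp hk
        · rcases Box.mem_split hmem'' 1 (49/100) with hmem''' | hmem'''
          · exact inertial_of_cert (D := dO) (k := 9) dO_elimOK_9 cert_dO_O_carve_2 (by norm_num) hmem''' h0 hc hX hLo hUp hk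
          · exact inertial_of_cert (D := dO) (k := 9) dO_elimOK_9 cert_dO_O_carve_3 (by norm_num) hmem''' h0 hc hX hLo hUp hk
      · rcases Box.mem_split hmem' 2 (147/200) with hmem'' | hmem''
        · rcases Box.mem_split hmem'' 5 (49/100) with hmem''' | hmem'''
          · rcases Box.mem_split hmem''' 0 (49/100) with hmem'''' | hmem''''
            · exact inertial_of_cert (D := dO) (k := 9) dO_elimOK_9 cert_dO_O_carve_4 (by norm_num) hmem'''' h0 hc hX hLo hUp hk
            · rcases Box.mem_split hmem'''' 2 (49/80) with hmem''''' | hmem'''''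
              · exact inertial_of_cert (D := dO) (k := 9) dO_elimOK_9 cert_dO_O_carve_5 (by norm_num) hmem''''' h0 hc hX hLo hUp hk
              · exact inertial_of_cert (D := dO) (k := 9) dO_elimOK_9 cert_dO_O_carve_6 (by norm_num) hmem''''' h0 hc hX hLo hUp hk
          · rcases Box.mem_split hmem''' 1 (49/100) with hmem'''' | hmem''''
            · exact inertial_of_cert (D := dO) (k := 9) dO_elimOK_9 cert_dO_O_carve_7 (by norm_num) hmem'''' h0 hc hX hLo hUp hk
            · rcases Box.mem_split hmem'''' 1 (147/200) with hmem''''' | hmem'''''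
              · exact inertial_of_cert (D := dO) (k := 9) dO_elimOK_9 cert_dO_O_carve_8 (by norm_num) hmem''''' h0 hc hX hLo hUp hk
              · rcases Box.mem_split hmem''''' 0 (49/100) with hmem'''''' | hmem''''''
                · exact inertial_of_cert (D := dO) (k := 9) dO_elimOK_9 cert_dO_O_carve_9 (by norm_num) hmem'''''' h0 hc hX hLo hUp hk
                · rcases Box.mem_split hmem'''''' 0 (147/200) with hmem''''''' | hmem'''''''
                  · exact inertial_of_cert (D := dO) (k := 9) dO_elimOK_9 cert_dO_O_carve_10 (by norm_num) hmem''''''' h0 hc hX hLo hUp hk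
                  · rcases Box.mem_split hmem''''''' 2 (49/80) with hmem'''''''' | hmem''''''''
                    · rcases Box.mem_split hmem'''''''' 1 (343/400) with hmem''''''''' | hmem'''''''''
                      · exact inertial_of_cert (D := dO) (k := 9) dO_elimOK_9 cert_dO_O_carve_11 (by norm_num) hmem''''''''' h0 hc hX hLo hUp hk
                      · rcases Box.mem_split hmem''''''''' 2 (441/800) with hmem'''''''''' | hmem''''''''''
                        · rcases Box.mem_split hmem'''''''''' 1 (147/160) with hmem''''''''''' | hmem'''''''''''
                          · exact inertial_of_cert (D := dO) (k := 9) dO_elimOK_9 cert_dO_O_carve_12 (by norm_num) hmem''''''''''' h0 hc hX hLo hUp hk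
                          · rcases Box.mem_split hmem''''''''''' 2 (833/1600) with hmem'''''''''''' | hmem''''''''''''
                            · exact inertial_of_cert (D := dO) (k := 9) dO_elimOK_9 cert_dO_O_carve_13 (by norm_num) hmem'''''''''''' h0 hc hX hLo hUp hk
                            · exact inertial_of_cert (D := dO) (k := 9) dO_elimOK_9 cert_dO_O_carve_14 (by norm_num) hmem'''''''''''' h0 hc hX hLo hUp hk
                        · exact inertial_of_cert (D := dO) (k := 9) dO_elimOK_9 cert_dO_O_carve_15 (by norm_num) hmem'''''''''' h0 hc hX hLo hUp hk
                    · rcases Box.mem_split hmem'''''''' 0 (343/400) with hmem''''''''' | hmem'''''''''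
                      · exact inertial_of_cert (D := dO) (k := 9) dO_elimOK_9 cert_dO_O_carve_16 (by norm_num) hmem''''''''' h0 hc hX hLo hUp hk
                      · rcases Box.mem_split hmem''''''''' 2 (539/800) with hmem'''''''''' | hmem''''''''''
                        · exact inertial_of_cert (D := dO) (k := 9) dO_elimOK_9 cert_dO_O_carve_17 (by norm_num) hmem'''''''''' h0 hc hX hLo hUp hk
                        · rcases Box.mem_split hmem'''''''''' 2 (1127/1600) with hmem''''''''''' | hmem'''''''''''
                          · exact inertial_of_cert (D := dO) (k := 9) dO_elimOK_9 cert_dO_O_carve_18 (by norm_num) hmem''''''''''' h0 hc hX hLo hUp hk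
                          · rcases Box.mem_split hmem''''''''''' 1 (343/400) with hmem'''''''''''' | hmem''''''''''''
                            · exact inertial_of_cert (D := dO) (k := 9) dO_elimOK_9 cert_dO_O_carve_19 (by norm_num) hmem'''''''''''' h0 hc hX hLo hUp hk
                            · rcases Box.mem_split hmem'''''''''''' 0 (147/160) with hmem''''''''''''' | hmem'''''''''''''
                              · exact inertial_of_cert (D := dO) (k := 9) dO_elimOK_9 cert_dO_O_carve_20 (by norm_num) hmem''''''''''''' h0 hc hX hLo hUp hk
                              · exact inertial_of_cert (D := dO) (k := 9) dO_elimOK_9 cert_dO_O_carve_21 (by norm_num) hmem''''''''''''' h0 hc hX hLo hUp hk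
        · rcases Box.mem_split hmem'' 2 (343/400) with hmem''' | hmem'''
          · rcases Box.mem_split hmem''' 5 (49/100) with hmem'''' | hmem''''
            · rcases Box.mem_split hmem'''' 1 (49/100) with hmem''''' | hmem'''''
              · exact inertial_of_cert (D := dO) (k := 9) dO_elimOK_9 cert_dO_O_carve_22 (by norm_num) hmem''''' h0 hc hX hLo hUp hk
              · rcases Box.mem_split hmem''''' 2 (637/800) with hmem'''''' | hmem''''''
                · rcases Box.mem_split hmem'''''' 0 (49/100) with hmem''''''' | hmem'''''''
                  · exact inertial_of_cert (D := dO) (k := 9) dO_elimOK_9 cert_dO_O_carve_23 (by norm_num) hmem''''''' h0 hc hX hLo hUp hk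
                  · rcases Box.mem_split hmem''''''' 1 (147/200) with hmem'''''''' | hmem''''''''
                    · exact inertial_of_cert (D := dO) (k := 9) dO_elimOK_9 cert_dO_O_carve_24 (by norm_num) hmem'''''''' h0 hc hX hLo hUp hk
                    · rcases Box.mem_split hmem'''''''' 2 (49/64) with hmem''''''''' | hmem'''''''''
                      · exact inertial_of_cert (D := dO) (k := 9) dO_elimOK_9 cert_dO_O_carve_25 (by norm_num) hmem''''''''' h0 hc hX hLo hUp hk
                      · exact inertial_of_cert (D := dO) (k := 9) dO_elimOK_9 cert_dO_O_carve_26 (by norm_num) hmem''''''''' h0 hc hX hLo hUp hk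
                · exact inertial_of_cert (D := dO) (k := 9) dO_elimOK_9 cert_dO_O_carve_27 (by norm_num) hmem'''''' h0 hc hX hLo hUp hk
            · rcases Box.mem_split hmem'''' 2 (637/800) with hmem''''' | hmem'''''
              · rcases Box.mem_split hmem''''' 0 (49/100) with hmem'''''' | hmem''''''
                · exact inertial_of_cert (D := dO) (k := 9) dO_elimOK_9 cert_dO_O_carve_28 (by norm_num) hmem'''''' h0 hc hX hLo hUp hk
                · rcases Box.mem_split hmem'''''' 5 (147/200) with hmem''''''' | hmem'''''''
                  · exact inertial_of_cert (D := dO) (k := 9) dO_elimOK_9 cert_dO_O_carve_29 (by norm_num) hmem''''''' h0 hc hX hLo hUp hk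
                  · rcases Box.mem_split hmem''''''' 1 (49/100) with hmem'''''''' | hmem''''''''
                    · exact inertial_of_cert (D := dO) (k := 9) dO_elimOK_9 cert_dO_O_carve_30 (by norm_num) hmem'''''''' h0 hc hX hLo hUp hk
                    · rcases Box.mem_split hmem'''''''' 1 (147/200) with hmem''''''''' | hmem'''''''''
                      · exact inertial_of_cert (D := dO) (k := 9) dO_elimOK_9 cert_dO_O_carve_31 (by norm_num) hmem''''''''' h0 hc hX hLo hUp hk
                      · rcases Box.mem_split hmem''''''''' 0 (147/200) with hmem'''''''''' | hmem''''''''''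
                        · exact inertial_of_cert (D := dO) (k := 9) dO_elimOK_9 cert_dO_O_carve_32 (by norm_num) hmem'''''''''' h0 hc hX hLo hUp hk
                        · rcases Box.mem_split hmem'''''''''' 0 (343/400) with hmem''''''''''' | hmem'''''''''''
                          · exact inertial_of_cert (D := dO) (k := 9) dO_elimOK_9 cert_dO_O_carve_33 (by norm_num) hmem''''''''''' h0 hc hX hLo hUp hk
                          · rcases Box.mem_split hmem''''''''''' 2 (49/64) with hmem'''''''''''' | hmem''''''''''''
                            · rcases Box.mem_split hmem'''''''''''' 1 (343/400) with hmem''''''''''''' | hmem'''''''''''''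
                              · exact inertial_of_cert (D := dO) (k := 9) dO_elimOK_9 cert_dO_O_carve_34 (by norm_num) hmem''''''''''''' h0 hc hX hLo hUp hk
                              · rcases Box.mem_split hmem''''''''''''' 1 (147/160) with hmem'''''''''''''' | hmem''''''''''''''
                                · exact inertial_of_cert (D := dO) (k := 9) dO_elimOK_9 cert_dO_O_carve_35 (by norm_num) hmem'''''''''''''' h0 hc hX hLo hUp hk
                                · rcases Box.mem_split hmem'''''''''''''' 2 (2401/3200) with hmem''''''''''''''' | hmem'''''''''''''''
                                  · exact inertial_of_cert (D := dO) (k := 9) dO_elimOK_9 cert_dO_O_carve_36 (by norm_num) hmem''''''''''''''' h0 hc hX hLo hUp hk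
                                  · rcases Box.mem_split hmem''''''''''''''' 0 (147/160) with hmem'''''''''''''''' | hmem''''''''''''''''
                                    · exact inertial_of_cert (D := dO) (k := 9) dO_elimOK_9 cert_dO_O_carve_37 (by norm_num) hmem'''''''''''''''' h0 hc hX hLo hUp hk
                                    · exact inertial_of_cert (D := dO) (k := 9) dO_elimOK_9 cert_dO_O_carve_38 (by norm_num) hmem'''''''''''''''' h0 hc hX hLo hUp hk
                            · rcases Box.mem_split hmem'''''''''''' 1 (343/400) with hmem''''''''''''' | hmem'''''''''''''
                              · exact inertial_of_cert (D := dO) (k := 9) dO_elimOK_9 cert_dO_O_carve_39 (by norm_num) hmem''''''''''''' h0 hc hX hLo hUp hk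
                              · rcases Box.mem_split hmem''''''''''''' 1 (147/160) with hmem'''''''''''''' | hmem''''''''''''''
                                · exact inertial_of_cert (D := dO) (k := 9) dO_elimOK_9 cert_dO_O_carve_40 (by norm_num) hmem'''''''''''''' h0 hc hX hLo hUp hk
                                · rcases Box.mem_split hmem'''''''''''''' 2 (2499/3200) with hmem''''''''''''''' | hmem'''''''''''''''
                                  · rcases Box.mem_split hmem''''''''''''''' 0 (147/160) with hmem'''''''''''''''' | hmem''''''''''''''''
                                    · exact inertial_of_cert (D := dO) (k := 9) dO_elimOK_9 cert_dO_O_carve_41 (by norm_num) hmem'''''''''''''''' h0 hc hX hLo hUp hk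
                                    · exact inertial_of_cert (D := dO) (k := 9) dO_elimOK_9 cert_dO_O_carve_42 (by norm_num) hmem'''''''''''''''' h0 hc hX hLo hUp hk
                                  · exact inertial_of_cert (D := dO) (k := 9) dO_elimOK_9 cert_dO_O_carve_43 (by norm_num) hmem''''''''''''''' h0 hc hX hLo hUp hk
              · rcases Box.mem_split hmem''''' 1 (49/100) with hmem'''''' | hmem''''''
                · exact inertial_of_cert (D := dO) (k := 9) dO_elimOK_9 cert_dO_O_carve_44 (by norm_num) hmem'''''' h0 hc hX hLo hUp hk
                · rcases Box.mem_split hmem'''''' 0 (49/100) with hmem''''''' | hmem'''''''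
                  · exact inertial_of_cert (D := dO) (k := 9) dO_elimOK_9 cert_dO_O_carve_45 (by norm_num) hmem''''''' h0 hc hX hLo hUp hk
                  · rcases Box.mem_split hmem''''''' 1 (147/200) with hmem'''''''' | hmem''''''''
                    · exact inertial_of_cert (D := dO) (k := 9) dO_elimOK_9 cert_dO_O_carve_46 (by norm_num) hmem'''''''' h0 hc hX hLo hUp hk
                    · rcases Box.mem_split hmem'''''''' 0 (147/200) with hmem''''''''' | hmem'''''''''
                      · exact inertial_of_cert (D := dO) (k := 9) dO_elimOK_9 cert_dO_O_carve_47 (by norm_num) hmem''''''''' h0 hc hX hLo hUp hk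
                      · rcases Box.mem_split hmem''''''''' 1 (343/400) with hmem'''''''''' | hmem''''''''''
                        · exact inertial_of_cert (D := dO) (k := 9) dO_elimOK_9 cert_dO_O_carve_48 (by norm_num) hmem'''''''''' h0 hc hX hLo hUp hk
                        · rcases Box.mem_split hmem'''''''''' 2 (1323/1600) with hmem''''''''''' | hmem'''''''''''
                          · rcases Box.mem_split hmem''''''''''' 1 (147/160) with hmem'''''''''''' | hmem''''''''''''
                            · exact inertial_of_cert (D := dO) (k := 9) dO_elimOK_9 cert_dO_O_carve_49 (by norm_num) hmem'''''''''''' h0 hc hX hLo hUp hk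
                            · exact inertial_of_cert (D := dO) (k := 9) dO_elimOK_9 cert_dO_O_carve_50 (by norm_num) hmem'''''''''''' h0 hc hX hLo hUp hk
                          · exact inertial_of_cert (D := dO) (k := 9) dO_elimOK_9 cert_dO_O_carve_51 (by norm_num) hmem''''''''''' h0 hc hX hLo hUp hk
          · exact inertial_of_cert (D := dO) (k := 9) dO_elimOK_9 cert_dO_O_carve_52 (by norm_num) hmem''' h0 hc hX hLo hUp hk
    · exact inertial_of_cert (D := dO) (k := 10) dO_elimOK_10 cert_dO_O_rat0 (by norm_num) hmem h0 hc hX hLo hUp hk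
    · rcases Box.mem_split hmem 1 (49/100) with hmem' | hmem'
      · rcases Box.mem_split hmem' 0 (49/100) with hmem'' | hmem''
        · rcases Box.mem_split hmem'' 1 (49/200) with hmem''' | hmem'''
          · exact inertial_of_cert (D := dO) (k := 11) dO_elimOK_11 cert_dO_O_rat1_1 (by norm_num) hmem''' h0 hc hX hLo hUp hk
          · exact inertial_of_cert (D := dO) (k := 11) dO_elimOK_11 cert_dO_O_rat1_2 (by norm_num) hmem''' h0 hc hX hLo hUp hk
        · exact inertial_of_cert (D := dO) (k := 11) dO_elimOK_11 cert_dO_O_rat1_3 (by norm_num) hmem'' h0 hc hX hLo hUp hk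
      · exact inertial_of_cert (D := dO) (k := 11) dO_elimOK_11 cert_dO_O_rat1_4 (by norm_num) hmem' h0 hc hX hLo hUp hk
    · exact inertial_of_cert (D := dO) (k := 12) dO_elimOK_12 cert_dO_O_rat2 (by norm_num) hmem h0 hc hX hLo hUp hk
  · have hB20 : (0 : ℝ) ≤ b ^ 2 := by positivity
    have hB23 : b ^ 2 ≤ 3 := by nlinarith
    fin_cases k
    · exact Spec.face_damping (dO 0) dO_dampOK_0 x (b ^ 2) h0 hB20 hB23 hk
    · exact Spec.face_damping (dO 1) dO_dampOK_1 x (b ^ 2) h0 hB20 hB23 hk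
    · exact Spec.face_damping (dO 2) dO_dampOK_2 x (b ^ 2) h0 hB20 hB23 hk
    · exact Spec.face_damping (dO 3) dO_dampOK_3 x (b ^ 2) h0 hB20 hB23 hk
    · exact Spec.face_damping (dO 4) dO_dampOK_4 x (b ^ 2) h0 hB20 hB23 hk
    · exact Spec.face_damping (dO 5) dO_dampOK_5 x (b ^ 2) h0 hB20 hB23 hk
    · exact Spec.face_damping (dO 6) dO_dampOK_6 x (b ^ 2) h0 hB20 hB23 hk
    · exact Spec.face_damping (dO 7) dO_dampOK_7 x (b ^ 2) h0 hB20 hB23 hk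
    · exact damping_of_cert (D := dO) (k := 8) dO_elimOK_8 cert_dO_O_bulk_damp hmem h0 hc hX hLo hUp hk
    · exact damping_of_cert (D := dO) (k := 9) dO_elimOK_9 cert_dO_O_carve_damp hmem h0 hc hX hLo hUp hk
    · exact damping_of_cert (D := dO) (k := 10) dO_elimOK_10 cert_dO_O_rat0_damp hmem h0 hc hX hLo hUp hk
    · exact damping_of_cert (D := dO) (k := 11) dO_elimOK_11 cert_dO_O_rat1_damp hmem h0 hc hX hLo hUp hk
    · exact damping_of_cert (D := dO) (k := 12) dO_elimOK_12 cert_dO_O_rat2_damp hmem h0 hc hX hLo hUp hk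

/-! ## The chain barrier on the slice -/

/-- **The ν-uniform chain barrier `θ = 101/200` at every `b ∈ [34/25, 137/100]`** (spec-list design `dO`).
[cite: BarbatoMorandinRomito2011, §3.2 (the rescaling)] [cite: Tao2016AveragedNS, §4 (4.5), (4.13)] -/
theorem spec_gap_chain_O {b c₀ ν s x₀ : ℝ} (hb : (34 / 25 : ℝ) ≤ b) (hb' : b ≤ (137 / 100 : ℝ)) (hc₀ : 0 < c₀)
    (hν : 0 < ν) (hs : 0 < s) {Z : ℤ → ℝ → ℝ}
    (hdat : ∀ k : ℤ, Z k 0 = if k = 0 then x₀ else 0)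
    (hvan : ∀ t, Z (-1) t = 0)
    (hbdd : ∃ M : ℝ, ∀ (t : ℝ) (k : ℕ), (1 + b ^ ((10 : ℝ) * k)) * |Z k t| ≤ M)
    (hcont : ∀ k : ℕ, ContinuousOn (Z k) (Icc 0 s))
    (hode : ∀ k : ℕ, ∀ t ∈ Icc 0 s, HasDerivWithinAt (Z k)
      (c₀ * (b ^ ((5 : ℝ) * ((k : ℝ) - 1) / 2) * Z ((k : ℤ) - 1) t ^ 2 -
          b ^ ((5 : ℝ) * (k : ℝ) / 2) * (Z k t * Z ((k : ℤ) + 1) t)) -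
        ν * b ^ ((2 : ℝ) * (k : ℝ)) * Z k t) (Icc 0 s) t)
    (hnn : ∀ t ∈ Icc 0 s, ∀ k : ℕ, 1 ≤ k → 0 ≤ Z k t) :
    ∀ t ∈ Icc 0 s, ∀ k : ℕ, (b ^ ((101 : ℝ) / 200)) ^ (2 * k) * Z k t ^ 2 ≤ 100 * x₀ ^ 2 :=
  chain_le_of_coupledFaceCertB (g := fun k => (dO k).face) (dg := fun k => (dO k).grad)
    (by linarith) (by linarith) hc₀ (by norm_num : (49 / 50 : ℝ) ≤ 1) hν hs
    (fun k => (dO k).face_continuous) (fun k => (dO k).face_hasDerivWithinAt)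
    (design_init dO dO_initOK) (design_safe dO 2 ((49/50)) rfl (by norm_num)) (specSliceO_hFace hb hb')
    hdat hvan hbdd hcont hode hnn

end Summit.NavierStokesRegularity.NavierStokesRegularity.Theorems.VirtualFloor.GapSpec

end
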